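import Summits.AtomisticToContinuum.Crystallization.Theorems.ExcessDecayLiouvilleSiteGeometry

/-!
# Route `ExcessDecayLiouville`: optical balancing

Ingredient (OB) of the energy route for item `ExcessDecay` (stmt-AtomisticToContinuum-9334; item evidence
`ExcessDecay-proof-architecture-v5.md`, F4).  Constant forces of opposite sign on the two sublattices ("optical"
constants: the reference force `(F₀, −F₀)`, `L` of a per-sublattice constant field, the offset part of the nonlinearity)
do no work on a test field whose `η²`-weighted optical average vanishes:

* `tsum_inner_optical_eq_zero` : if `Σ'_p η_p² σ_p • h_p = 0` then `Σ'_p η_p² ⟪σ_p • c, h_p⟫ = 0` for every `c`;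
* `exists_opticalShift` : for bounded `u` (`‖u‖ ≤ B`), weights `η` of finite support in the sites and signs `σ = ±1` with
  `η²`-masses `M₀ = Σ'[σ=1] η² > 0` and `Σ' η² ≤ 2 M₀`, there is `b` with `‖b‖ ≤ 2B` such that the field
  `h_p = u_p − [σ_p = 1] b` is optically balanced, `Σ'_p η_p² σ_p • h_p = 0`.

(The balanced cutoff with equal `η²`-mass on the two sublattices is built from the radial one through the sublattice
flip in the assembly.)  All `[folklore]`; helper lemmas, nothing here closes an item.
-/

noncomputable section

namespace Summit.AtomisticToContinuum.Crystallization.Theorems.ExcessDecayLiouville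

open scoped BigOperators Topology InnerProductSpace RealInnerProductSpace Classical
open Literature.MathematicalPhysics.StatisticalMechanics
open Summit.AtomisticToContinuum.Crystallization.Theorems.PhononStabilityNegative

section

variable {t : Fin 2 → (EuclideanSpace ℝ (Fin 3))} {A : (EuclideanSpace ℝ (Fin 3)) →L[ℝ] (EuclideanSpace ℝ (Fin 3))}

/-- **Optical constants do no work on optically balanced fields.** [folklore] -/
theorem tsum_inner_optical_eq_zero {η σ : (EuclideanSpace ℝ (Fin 3)) → ℝ} (hη : (Function.support η).Finite)
    {h : (EuclideanSpace ℝ (Fin 3)) → (EuclideanSpace ℝ (Fin 3))} (hbal : ∑' p : Sites₀ t A, ((η p) ^ 2 * σ p) • h p = 0) (c : (EuclideanSpace ℝ (Fin 3))) :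
    ∑' p : Sites₀ t A, (η p) ^ 2 * ⟪σ p • c, h p⟫ = 0 := by
  classical
  have hfin : (Subtype.val ⁻¹' Function.support η : Set (Sites₀ t A)).Finite :=
    hη.preimage Subtype.val_injective.injOn
  set T := hfin.toFinset with hT
  have hTm : ∀ p : Sites₀ t A, p ∉ T → η p = 0 := by
    intro p hp
    by_contra h'
    exact hp ((Set.Finite.mem_toFinset _).2 h')
  have h1 : ∑' p : Sites₀ t A, (η p) ^ 2 * ⟪σ p • c, h p⟫ = ∑ p ∈ T, (η p) ^ 2 * ⟪σ p • c, h p⟫ :=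
    tsum_eq_sum fun p hp => by rw [hTm p hp]; ring
  have h2 : ∑' p : Sites₀ t A, ((η p) ^ 2 * σ p) • h p = ∑ p ∈ T, ((η p) ^ 2 * σ p) • h p :=
    tsum_eq_sum fun p hp => by rw [hTm p hp]; simp
  rw [h1]
  rw [h2] at hbal
  have h3 : ∑ p ∈ T, (η p) ^ 2 * ⟪σ p • c, h p⟫ = ⟪c, ∑ p ∈ T, ((η p) ^ 2 * σ p) • h p⟫ := by
    rw [inner_sum]
    refine Finset.sum_congr rfl fun p _ => ?_
    rw [real_inner_smul_left, real_inner_smul_right]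
    ring
  rw [h3, hbal, inner_zero_right]

/-- **The optical shift.** [folklore] -/
theorem exists_opticalShift {η σ : (EuclideanSpace ℝ (Fin 3)) → ℝ} (hη : (Function.support η).Finite)
    (hσ : ∀ x, σ x = 1 ∨ σ x = -1)
    {u : (EuclideanSpace ℝ (Fin 3)) → (EuclideanSpace ℝ (Fin 3))} {B : ℝ} (hB : ∀ x, ‖u x‖ ≤ B)
    {M₀ : ℝ} (hM₀ : 0 < M₀)
    (hM₀eq : ∑' p : Sites₀ t A, (if σ p = 1 then (η p) ^ 2 else 0) = M₀)
    (hmass : ∑' p : Sites₀ t A, (η p) ^ 2 ≤ 2 * M₀) :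
    ∃ b : (EuclideanSpace ℝ (Fin 3)), ‖b‖ ≤ 2 * B ∧
      ∑' p : Sites₀ t A, ((η p) ^ 2 * σ p) • (u p - (if σ p = 1 then b else 0)) = 0 := by
  classical
  have hfin : (Subtype.val ⁻¹' Function.support η : Set (Sites₀ t A)).Finite :=
    hη.preimage Subtype.val_injective.injOn
  set T := hfin.toFinset with hT
  have hTm : ∀ p : Sites₀ t A, p ∉ T → η p = 0 := by
    intro p hp
    by_contra h'
    exact hp ((Set.Finite.mem_toFinset _).2 h')
  -- the weighted optical sum of u
  set Su : (EuclideanSpace ℝ (Fin 3)) := ∑ p ∈ T, ((η p) ^ 2 * σ p) • u p with hSu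
  refine ⟨M₀⁻¹ • Su, ?_, ?_⟩
  · -- ‖b‖ ≤ (Σ η²) B / M₀ ≤ 2B
    have hSu_le : ‖Su‖ ≤ (∑ p ∈ T, (η p) ^ 2) * B := by
      refine (norm_sum_le _ _).trans ?_
      rw [Finset.sum_mul]
      refine Finset.sum_le_sum fun p _ => ?_
      rw [norm_smul, Real.norm_eq_abs, abs_mul, abs_pow, sq_abs]
      have hs : |σ p| = 1 := by rcases hσ p with h | h <;> simp [h]
      rw [hs, mul_one]
      exact mul_le_mul_of_nonneg_left (hB _) (sq_nonneg _)
    have hsumT : ∑ p ∈ T, (η p) ^ 2 = ∑' p : Sites₀ t A, (η p) ^ 2 :=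
      (tsum_eq_sum fun p hp => by rw [hTm p hp]; ring).symm
    rw [hsumT] at hSu_le
    rw [norm_smul, Real.norm_eq_abs, abs_inv, abs_of_pos hM₀]
    have hB0 : 0 ≤ B := (norm_nonneg _).trans (hB 0)
    calc M₀⁻¹ * ‖Su‖ ≤ M₀⁻¹ * (2 * M₀ * B) := by
          refine mul_le_mul_of_nonneg_left (hSu_le.trans ?_) (by positivity)
          exact mul_le_mul_of_nonneg_right hmass hB0
      _ = 2 * B := by field_simp
  · -- balance
    have hM₀T : ∑ p ∈ T, (if σ p = 1 then (η p) ^ 2 else 0) = M₀ := by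
      rw [← hM₀eq]
      exact (tsum_eq_sum fun p hp => by rw [hTm p hp]; simp).symm
    rw [tsum_eq_sum (s := T) (fun p hp => by rw [hTm p hp]; simp)]
    simp only [smul_sub, Finset.sum_sub_distrib]
    rw [← hSu]
    have hb : ∑ p ∈ T, ((η p) ^ 2 * σ p) • (if σ p = 1 then M₀⁻¹ • Su else 0) =
        (∑ p ∈ T, (if σ p = 1 then (η p) ^ 2 else 0)) • (M₀⁻¹ • Su) := by
      rw [Finset.sum_smul]
      refine Finset.sum_congr rfl fun p _ => ?_
      split_ifs with h1
      · rw [h1, mul_one]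
      · rw [smul_zero, zero_smul]
    rw [hb, hM₀T, smul_smul, mul_inv_cancel₀ hM₀.ne', one_smul, sub_self]

end

end Summit.AtomisticToContinuum.Crystallization.Theorems.ExcessDecayLiouville

end
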